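import Summits.QuantumFields.GaugeBoot.Eqs.BindKitZ
import HarnessLib

/-!
# Aggregated equality row of `beta-200-91-upper.conic1.json` — witness piece 2/2 (data)

Cell `pub-gaugeboot` (HOME `run/shared/lean/pub/pub-gaugeboot/`), seat lean2 (KZ aggregated equality bindings; FANOUT-PLAN A126 (2)(c) /
A137 (1)(iii) / A146 / A152 (1)).  Certificate of record `certs/SU2-D4/kz-L2-rp/beta-200-91-upper.conic1.json` (sha256 field `d772ad322d0aadc3…`) over the
problem `certs/SU2-D4/kz-L2-rp/beta-200-91-upper.problem1.json` (`SU(2)`, `D = 4`, `β_std = 200/91`, 3300 equality rows, eng2's reduced form): its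
3300 exact equality multipliers `lamQ` (dyadic rationals; sha256 of the multiplier list `666a0c33daf20462…`) contract the
equality rows into ONE row `r = Σ_e lamQ_e · row_e` (9983 labelled terms, right-hand side Σ_e lamQ_e · rhs_e = 0) — the only way
the certificate replay (lean3's `_of_feasible_agg` shape) uses the equality system.  The row is INTEGER-CODED (`Eqs/BindKitZ`: `(terms, M, K,
witness)`, terms `tz <label code> <z>` with coefficient `z / M` exactly, witness `lz <m> <def id> <position>` = an exact combination of
3300 of the family's G1 theorem rows `KZL2rpD4LitsZ*.litZ`, `μ = Σ_e lamQ_e · Λ_e` from the seat's exact elimination witnesses `Λ`,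
re-verified exactly in the seat).  Because of its size the row is spread over several modules: term pieces `…Z200o91UT<k>` and the
witness pieces `…Z200o91UW<k>` and the assembly `…Z200o91UR` (data only), and the final module `Eqs/KZL2rpD4Z200o91U` with the `m = 7` residue-class
kernel checks `chk<i>` (`Eqs/BindKitZPF.cchkZPf litZ p q 7 i` — the `BindKitZP` residue-class check with the class filter inside the combination; integer arithmetic only, one `decide` each, ≈ 21 s measured) and `Ecode`, `E_holds`, `rowSum4_row` (
`rowSum4 200/91 L r = 0` on every torus `(ℤ/L)^4` with `L ≥ 6`).  Positivity blocks and the certificate inequalities are NOT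
treated here.  GENERATED by `scratch/agg_data.py` + `scratch/gen_aggZP.py`.

HONEST FRAMING (page 1 of every file of this cell): certified bounds on lattice expectations at STATED coupling, gauge
group, dimension and torus size; NOT a mass gap, NOT a continuum limit, NOT a string tension, NOT large `N`; NOT
Yang–Mills-summit-bearing (barriers `FixedCouplingUltralocality`, `PerturbativeInvisibility`).
-/

noncomputable section

open Literature.MathematicalPhysics.QuantumFieldTheory
open Summit.QuantumFields.GaugeBoot.BindN Summit.QuantumFields.GaugeBoot.BindZ

namespace Summit.QuantumFields.GaugeBoot.KZL2rpD4.Z200o91U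

variable {L : ℕ} [NeZero L]

set_option maxRecDepth 100000 in
/-- Witness entries 3271–3299: `lz <m> <def id> <position>` over `KZL2rpD4LitsZ*.litZ`. -/
def wit2 : List (ℤ × ℕ × ℕ) := [
  lz 35955375954472611000000000 52 85, lz 249868372437336474057600000 52 86, lz (-6789106247310796500000000) 52 89, lz 4571641361480492589790500000000 52 90, lz 97127719846890642000000000 53 0, lz 11846595089953260000000000 53 5, lz (-9874212917312835000000000) 53 6, lz (-541877225361058788713694000000000) 53 10, lz (-8374125408175800000000000) 53 11, lz (-78393223989447003000000000) 53 12, lz 4559959683553554517828500000000 53 13, lz 1039923093042717167950848000000000 53 14, lz 1402831514359330611839829000000000 53 15, lz 9301815347111469000000000 53 16, lz (-41845216990733793000000000) 53 17, lz (-112015038510737271000000000) 53 18, lz (-2584211648341050000000000) 53 19, lz 6015004319581803000000000 53 21, lz (-39041591555067192000000000) 53 22, lz 7484187249009198000000000 53 29, lz 368454636374231043000000000 53 30, lz (-95840353037260050022030500000000) 53 32,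
  lz 138873823438224420000000000 53 34, lz 1311489531412287190750332000000000 53 36, lz 1609925358051438428459277000000000 53 40, lz (-29523615283701630000000000) 53 41, lz 52294916613701853000000000 53 44, lz 32410345049212221000000000 53 49, lz (-551365768599981641577589500000000) 53 65]

end Summit.QuantumFields.GaugeBoot.KZL2rpD4.Z200o91U

end
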